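import Summits.AtomisticToContinuum.Crystallization.Theorems.PricedLinkCensusLocalToGlobalFccMirrorWallCut
import Summits.AtomisticToContinuum.Crystallization.Theorems.PricedLinkCensusLocalToGlobalFccMirrorSmearedWeak

/-!
# From Gauss laws inside a polyhedral tube to the tube-restricted Gauss law, for fields tangent to the walls

Route `PricedLinkCensus`, crux `LocalToGlobal` (stmt-AtomisticToContinuum-14232), line
`flux-cell-joint-census`, support for the registered stub `stub_fccMirrorExact : NewtonShell8 → FccMirrorExact`
(`Theorems/PricedLinkCensusLocalToGlobalDefs`), second half (`fluxCell ≤ S₆`).  THE WALL LEMMA OF THE METHOD OF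
IMAGES (registered sub-goal `fccMirror_wall`).  Let `U = {z ∈ ℝ⁸ : ⟪z, Wₘ⟫ < αₘ, m ∈ M}` be a finite intersection
of open half-spaces, `B ⊆ U` a ball, and `F : ℝ⁸ → ℝ⁸` a CONTINUOUS field which is TANGENT TO EVERY WALL PLANE
(`⟪F z, Wₘ⟫ = 0` whenever `⟪z, Wₘ⟫ = αₘ`) and satisfies the Gauss law `∫ ⟪F, ∇Φ⟫ = -⨍_B Φ` for all tests `Φ`
supported in `U`.  Then for EVERY test `φ ∈ C¹_c(ℝ⁸)`

  `∫_U ⟪F, ∇φ⟫ = -⨍_B φ`,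

i.e. `𝟙_U F` is an admissible confined flux with zero wall data.  Proof: test with `φ · polyCut n`
(`PricedLinkCensusLocalToGlobalFccMirrorWallCut`); `∫ polyCut n ⟪F, ∇φ⟫ → ∫_U ⟪F, ∇φ⟫` and
`⨍_B φ polyCut n → ⨍_B φ` by dominated convergence; the wall term `∫ φ ⟪F, ∇ polyCut n⟫` is a sum over the walls
of layer integrals `∫ n θ′ₘ · (…) · ⟪F, Wₘ⟫` over the layers `1/n ≤ αₘ - ⟪z, Wₘ⟫ ≤ 2/n`, where `⟪F, Wₘ⟫` is
uniformly small (uniform continuity of `F` near the support of `φ` and tangency at the foot point on the wall)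
while `∫ n θ′ₘ χ` stays bounded (the wall-layer integration by parts) — so it tends to `0`.

References: W. Thomson (Lord Kelvin), method of images (1848); L. C. Evans, *PDE* (2010), App. C.2, C.4; folklore.
-/

noncomputable section

open MeasureTheory Set Filter Metric Topology InnerProductSpace Function
open scoped RealInnerProductSpace BigOperators

namespace Summit.AtomisticToContinuum.Crystallization.Theorems.PricedLinkCensusLocalToGlobal

section Wall

variable {ι : Type*} {M : Finset ι} {W : ι → E8} {α : ι → ℝ} {F : E8 → E8}

/-- **Smallness of the normal component in the wall layers.** If `F` is continuous and tangent to the wall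
`⟪z, W⟫ = α` (`W ≠ 0`), then on any compact `K`, `|⟪F z, W⟫| ≤ ε` throughout the layer
`1/(n+1) ≤ α - ⟪z, W⟫ ≤ 2/(n+1)` for all large `n`. [folklore] -/
theorem eventually_abs_inner_le_of_tangent {W₀ : E8} (hW : W₀ ≠ 0) {α₀ : ℝ} (hF : Continuous F)
    (hwall : ∀ z : E8, ⟪z, W₀⟫ = α₀ → ⟪F z, W₀⟫ = 0) {K : Set E8} (hK : IsCompact K) {ε : ℝ} (hε : 0 < ε) :
    ∀ᶠ n : ℕ in atTop, ∀ z ∈ K, 1 / ((n : ℝ) + 1) ≤ α₀ - ⟪z, W₀⟫ → α₀ - ⟪z, W₀⟫ ≤ 2 / ((n : ℝ) + 1) →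
      |⟪F z, W₀⟫| ≤ ε := by
  have hWn : 0 < ‖W₀‖ := norm_pos_iff.2 hW
  -- uniform continuity of `F` on the compact `1`-thickening of `K`
  have hK₁ : IsCompact (cthickening 1 K) := hK.cthickening
  have huc := hK₁.uniformContinuousOn_of_continuous hF.continuousOn
  obtain ⟨δ, hδ, hδF⟩ := Metric.uniformContinuousOn_iff.1 huc (ε / ‖W₀‖) (div_pos hε hWn)
  -- `2/((n+1)‖W₀‖) < min δ 1` eventually
  have hlim : Tendsto (fun n : ℕ => 2 / (((n : ℝ) + 1) * ‖W₀‖)) atTop (𝓝 0) := by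
    have h1 : Tendsto (fun n : ℕ => ((n : ℝ) + 1) * ‖W₀‖) atTop atTop :=
      (tendsto_atTop_add_const_right _ 1 tendsto_natCast_atTop_atTop).atTop_mul_const hWn
    exact tendsto_const_nhds.div_atTop h1
  filter_upwards [(tendsto_order.1 hlim).2 _ (lt_min hδ one_pos)] with n hn z hzK h1 h2
  have hn1 : (0 : ℝ) < (n : ℝ) + 1 := by positivity
  set g : ℝ := α₀ - ⟪z, W₀⟫ with hg
  have hg0 : 0 ≤ g := le_trans (by positivity) h1
  -- the foot point on the wall
  set z₀ : E8 := z + (g / ‖W₀‖ ^ 2) • W₀ with hz₀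
  have hwall₀ : ⟪z₀, W₀⟫ = α₀ := by
    rw [hz₀, inner_add_left, inner_smul_left, real_inner_self_eq_norm_sq, RCLike.conj_to_real,
      div_mul_cancel₀ _ (pow_ne_zero 2 hWn.ne')]
    rw [hg]; ring
  have hdist : dist z z₀ < min δ 1 := by
    rw [dist_eq_norm, hz₀, sub_add_cancel_left, norm_neg, norm_smul, Real.norm_of_nonneg (by positivity),
      div_mul_eq_mul_div, pow_two, mul_div_mul_right _ _ hWn.ne']
    calc g / ‖W₀‖ ≤ 2 / ((n : ℝ) + 1) / ‖W₀‖ := div_le_div_of_nonneg_right h2 hWn.le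
      _ = 2 / (((n : ℝ) + 1) * ‖W₀‖) := by rw [div_div]
      _ < min δ 1 := hn
  have hz₀K : z₀ ∈ cthickening 1 K :=
    mem_cthickening_of_dist_le z₀ z 1 K hzK (by rw [dist_comm]; exact (hdist.trans_le (min_le_right _ _)).le)
  have hzK₁ : z ∈ cthickening 1 K := self_subset_cthickening K hzK
  have hF := hδF z hzK₁ z₀ hz₀K (hdist.trans_le (min_le_left _ _))
  rw [dist_eq_norm] at hF
  have h0 : ⟪F z, W₀⟫ = ⟪F z - F z₀, W₀⟫ := by rw [inner_sub_left, hwall z₀ hwall₀, sub_zero]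
  rw [h0]
  calc |⟪F z - F z₀, W₀⟫| ≤ ‖F z - F z₀‖ * ‖W₀‖ := abs_real_inner_le_norm _ _
    _ ≤ ε / ‖W₀‖ * ‖W₀‖ := mul_le_mul_of_nonneg_right hF.le (norm_nonneg _)
    _ = ε := div_mul_cancel₀ ε hWn.ne'

/-- A smooth bump dominating the indicator of a compact set: `χ ∈ C¹_c`, `0 ≤ χ`, `χ = 1` on `K`. [folklore] -/
theorem exists_bump_ge_indicator {K : Set E8} (hK : IsCompact K) :
    ∃ χ : E8 → ℝ, ContDiff ℝ 1 χ ∧ HasCompactSupport χ ∧ (∀ z, 0 ≤ χ z) ∧ ∀ z ∈ K, χ z = 1 := by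
  obtain ⟨R, hR⟩ := hK.isBounded.subset_closedBall (0 : E8)
  let b : ContDiffBump (0 : E8) := ⟨max R 0 + 1, max R 0 + 2, by positivity, by linarith⟩
  refine ⟨b, b.contDiff.of_le (by exact_mod_cast le_top), b.hasCompactSupport, fun z => b.nonneg, fun z hz => ?_⟩
  refine b.one_of_mem_closedBall ?_
  have := hR hz
  rw [mem_closedBall, dist_zero_right] at this ⊢
  linarith [le_max_left R 0]

/-- **The wall term of one wall tends to zero.** For `F` continuous and tangent to the wall `⟪z, W⟫ = α`
(`W ≠ 0`), `φ ∈ C¹_c`, and weights `P n : ℝ⁸ → [0, 1]`: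
`∫ (n+1) θ′((n+1)(α - ⟪z, W⟫) - 1) P n z φ z ⟪F z, W⟫ dz → 0`. [folklore] -/
theorem tendsto_layer_integral {W₀ : E8} (hW : W₀ ≠ 0) (α₀ : ℝ) (hF : Continuous F)
    (hwall : ∀ z : E8, ⟪z, W₀⟫ = α₀ → ⟪F z, W₀⟫ = 0) {φ : E8 → ℝ} (hφ : IsTest φ) {P : ℕ → E8 → ℝ}
    (hP : ∀ n z, P n z ∈ Icc (0 : ℝ) 1) :
    Tendsto (fun n : ℕ => ∫ z, ((n : ℝ) + 1) * deriv Real.smoothTransition (((n : ℝ) + 1) * (α₀ - ⟪z, W₀⟫) - 1) *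
      (P n z * φ z * ⟪F z, W₀⟫)) atTop (𝓝 0) := by
  obtain ⟨Kφ, hK0, hKφ, -⟩ := exists_bounds_of_test hφ.1 hφ.2
  have hK : IsCompact (tsupport φ) := hφ.2
  obtain ⟨χ, hχ, hχc, hχ0, hχ1⟩ := exists_bump_ge_indicator hK
  set D : ℝ := (‖W₀‖ ^ 2)⁻¹ * ∫ z, |fderiv ℝ χ z W₀| with hD
  have hD0 : 0 ≤ D := mul_nonneg (by positivity) (integral_nonneg fun _ => abs_nonneg _)
  -- abbreviations
  set ρ : ℕ → E8 → ℝ := fun n z => ((n : ℝ) + 1) * deriv Real.smoothTransition (((n : ℝ) + 1) * (α₀ - ⟪z, W₀⟫) - 1) with hρ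
  have hρ0 : ∀ n z, 0 ≤ ρ n z := fun n z => mul_nonneg (by positivity) (Real.smoothTransition.monotone.deriv_nonneg)
  have hθ'c : Continuous (deriv Real.smoothTransition) := (Real.smoothTransition.contDiff (n := 1)).continuous_deriv le_rfl
  have hρc : ∀ n, Continuous (ρ n) := fun n =>
    continuous_const.mul (hθ'c.comp
      ((continuous_const.mul (continuous_const.sub (continuous_id.inner continuous_const))).sub continuous_const))
  -- the layer IBP bound, in the form `∫ ρ n χ ≤ D`
  have hIBP : ∀ n : ℕ, ∫ z, ρ n z * χ z ≤ D := fun n => by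
    have h := integral_layer_mul_le hW α₀ (n + 1) hχ hχc
    push_cast at h
    exact h
  refine Metric.tendsto_atTop.2 fun ε hε => ?_
  -- smallness of `⟪F, W₀⟫` in the layers over `tsupport φ`
  set ε₁ : ℝ := ε / (2 * (Kφ * D + 1)) with hε₁def
  have hε₁ : 0 < ε₁ := by positivity
  obtain ⟨N, hN⟩ := eventually_atTop.1 (eventually_abs_inner_le_of_tangent hW hF hwall hK hε₁)
  refine ⟨N, fun n hn => ?_⟩
  have hn1 : (1 : ℕ) ≤ n + 1 := Nat.le_add_left 1 n
  -- pointwise domination of the integrand by `Kφ ε₁ ρ χ`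
  have hdom : ∀ z, ‖ρ n z * (P n z * φ z * ⟪F z, W₀⟫)‖ ≤ Kφ * ε₁ * (ρ n z * χ z) := fun z => by
    rw [Real.norm_eq_abs, abs_mul, abs_of_nonneg (hρ0 n z)]
    by_cases hz : z ∈ tsupport φ
    · by_cases hρz : deriv Real.smoothTransition (((n : ℝ) + 1) * (α₀ - ⟪z, W₀⟫) - 1) = 0
      · have : ρ n z = 0 := by rw [hρ]; simp only; rw [hρz, mul_zero]
        rw [this]; simp
      · have hlayer := layer_of_deriv_ne_zero W₀ α₀ (n + 1) hn1 (by push_cast; exact hρz)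
        push_cast at hlayer
        have hsmall := hN n hn z hz hlayer.1 hlayer.2
        rw [hχ1 z hz, mul_one, abs_mul, abs_mul]
        have h1 : |P n z| ≤ 1 := by rw [abs_of_nonneg (hP n z).1]; exact (hP n z).2
        calc ρ n z * (|P n z| * |φ z| * |⟪F z, W₀⟫|) ≤ ρ n z * (1 * Kφ * ε₁) := by
              refine mul_le_mul_of_nonneg_left ?_ (hρ0 n z)
              exact mul_le_mul (mul_le_mul h1 (hKφ z) (abs_nonneg _) zero_le_one) hsmall (abs_nonneg _) (by positivity)
          _ = Kφ * ε₁ * (ρ n z * 1) := by ring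
          _ = Kφ * ε₁ * ρ n z := by rw [mul_one]
    · have : φ z = 0 := image_eq_zero_of_notMem_tsupport hz
      rw [this, mul_zero, zero_mul, abs_zero, mul_zero]
      exact mul_nonneg (by positivity) (mul_nonneg (hρ0 n z) (hχ0 z))
  have hint : Integrable fun z => Kφ * ε₁ * (ρ n z * χ z) :=
    (((hρc n).mul hχ.continuous).integrable_of_hasCompactSupport hχc.mul_left).const_mul _
  rw [dist_zero_right]
  calc ‖∫ z, ρ n z * (P n z * φ z * ⟪F z, W₀⟫)‖ ≤ ∫ z, Kφ * ε₁ * (ρ n z * χ z) :=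
        norm_integral_le_of_norm_le hint (Eventually.of_forall hdom)
    _ = Kφ * ε₁ * ∫ z, ρ n z * χ z := integral_const_mul _ _
    _ ≤ Kφ * ε₁ * D := mul_le_mul_of_nonneg_left (hIBP n) (by positivity)
    _ = ε * (Kφ * D) / (2 * (Kφ * D + 1)) := by rw [hε₁def]; ring
    _ < ε := by
        rw [div_lt_iff₀ (by positivity)]
        nlinarith [mul_nonneg hK0 hD0]

/-- **THE WALL LEMMA OF THE METHOD OF IMAGES.** Let `U = {z : ⟪z, Wₘ⟫ < αₘ, m ∈ M}` (`Wₘ ≠ 0`), `B(c, r) ⊆ U`,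
and let `F : ℝ⁸ → ℝ⁸` be continuous, tangent to every wall plane, and satisfy `∫ ⟪F, ∇Φ⟫ = -⨍_B Φ` for all tests
supported in `U`.  Then `∫_U ⟪F, ∇φ⟫ = -⨍_B φ` for every test `φ`. [folklore] -/
theorem setIntegral_inner_gradient_of_tangent (hWne : ∀ m ∈ M, W m ≠ 0) (hF : Continuous F)
    (hwall : ∀ m ∈ M, ∀ z : E8, ⟪z, W m⟫ = α m → ⟪F z, W m⟫ = 0) {c : E8} {r : ℝ}
    (hball : ball c r ⊆ {z | ∀ m ∈ M, ⟪z, W m⟫ < α m})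
    (hW0 : ∀ Φ : E8 → ℝ, IsTest Φ → tsupport Φ ⊆ {z | ∀ m ∈ M, ⟪z, W m⟫ < α m} →
      ∫ z, ⟪F z, gradient Φ z⟫ = -⨍ z in ball c r, Φ z)
    {φ : E8 → ℝ} (hφ : IsTest φ) :
    ∫ z in {z | ∀ m ∈ M, ⟪z, W m⟫ < α m}, ⟪F z, gradient φ z⟫ = -⨍ z in ball c r, φ z := by
  classical
  set U : Set E8 := {z | ∀ m ∈ M, ⟪z, W m⟫ < α m} with hU
  have hUo : IsOpen U := by
    have : U = ⋂ m ∈ M, {z : E8 | ⟪z, W m⟫ < α m} := by ext z; simp [hU]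
    rw [this]
    exact isOpen_biInter_finset fun m _ => isOpen_lt (continuous_id.inner continuous_const) continuous_const
  -- the cut-offs `Ψ n = polyCut (n+1)`
  set Ψ : ℕ → E8 → ℝ := fun n => polyCut M W α (n + 1) with hΨ
  have hn1 : ∀ n : ℕ, 1 ≤ n + 1 := fun n => Nat.le_add_left 1 n
  have hΨ1 : ∀ n, ContDiff ℝ 1 (Ψ n) := fun n => contDiff_polyCut M W α (n + 1)
  have hΨ01 : ∀ n z, Ψ n z ∈ Icc (0 : ℝ) 1 := fun n z => polyCut_mem_Icc M W α (n + 1) z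
  have hΨsupp : ∀ n, tsupport (Ψ n) ⊆ U := fun n => tsupport_polyCut_subset M W α (n + 1) (hn1 n)
  have hΨlim : ∀ z, Tendsto (fun n => Ψ n z) atTop (𝓝 (U.indicator (fun _ => (1 : ℝ)) z)) := fun z => by
    by_cases hz : z ∈ U
    · rw [indicator_of_mem hz]
      refine tendsto_const_nhds.congr' ?_
      have h := polyCut_eventually_eq_one M W α (z := z) hz
      have h' : ∀ᶠ n : ℕ in atTop, polyCut M W α (n + 1) z = 1 := (tendsto_add_atTop_nat 1).eventually h
      filter_upwards [h'] with n hn using hn.symm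
    · rw [indicator_of_notMem hz]
      exact tendsto_const_nhds.congr fun n => (polyCut_eq_zero_of_not_mem M W α (n + 1) (hn1 n) hz).symm
  obtain ⟨Kφ, hK0, hKφ, hKg⟩ := exists_bounds_of_test hφ.1 hφ.2
  have hgc : Continuous (gradient φ) := Literature.Analysis.FluidPDE.continuous_gradient_of_contDiff hφ.1
  have hinner : Continuous fun z => ⟪F z, gradient φ z⟫ := hF.inner hgc
  have hgcs : HasCompactSupport (gradient φ) :=
    (hφ.2.fderiv (𝕜 := ℝ)).comp_left (g := fun L : E8 →L[ℝ] ℝ => (InnerProductSpace.toDual ℝ E8).symm L) (map_zero _)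
  have hIi : Integrable fun z => ⟪F z, gradient φ z⟫ :=
    hinner.integrable_of_hasCompactSupport (hgcs.mono' fun z hz => by
      contrapose! hz
      have h0 : gradient φ z = 0 := image_eq_zero_of_notMem_tsupport hz
      rw [Function.mem_support, not_not, h0, inner_zero_right])
  -- (1) the tested identities
  have hI1 : ∀ n, Integrable fun z => Ψ n z * ⟪F z, gradient φ z⟫ := fun n =>
    hIi.bdd_mul (hΨ1 n).continuous.aestronglyMeasurable (c := 1) (Eventually.of_forall fun z => by
      rw [Real.norm_eq_abs, abs_of_nonneg (hΨ01 n z).1]; exact (hΨ01 n z).2)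
  have hgΨc : ∀ n, Continuous (gradient (Ψ n)) := fun n => Literature.Analysis.FluidPDE.continuous_gradient_of_contDiff (hΨ1 n)
  have hI2 : ∀ n, Integrable fun z => φ z * ⟪F z, gradient (Ψ n) z⟫ := fun n =>
    (hφ.1.continuous.mul (hF.inner (hgΨc n))).integrable_of_hasCompactSupport hφ.2.mul_right
  have hid : ∀ n, (∫ z, Ψ n z * ⟪F z, gradient φ z⟫) + ∫ z, φ z * ⟪F z, gradient (Ψ n) z⟫ =
      -⨍ z in ball c r, Ψ n z * φ z := fun n => by
    have htest : IsTest (fun z => Ψ n z * φ z) := ⟨(hΨ1 n).mul hφ.1, hφ.2.mul_left⟩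
    have hts : tsupport (fun z => Ψ n z * φ z) ⊆ U := (tsupport_mul_subset_left (f := Ψ n) (g := φ)).trans (hΨsupp n)
    rw [← hW0 _ htest hts, ← integral_add (hI1 n) (hI2 n)]
    refine integral_congr_ae (Eventually.of_forall fun z => ?_)
    exact (inner_gradient_mul_apply ((hΨ1 n).differentiable one_ne_zero z) (hφ.1.differentiable one_ne_zero z) (F z)).symm
  -- (2) the main terms converge to the tube integral
  have hL1 : Tendsto (fun n => ∫ z, Ψ n z * ⟪F z, gradient φ z⟫) atTop (𝓝 (∫ z in U, ⟪F z, gradient φ z⟫)) := by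
    rw [← integral_indicator hUo.measurableSet]
    refine tendsto_integral_of_dominated_convergence (fun z => ‖⟪F z, gradient φ z⟫‖) (fun n => (hI1 n).aestronglyMeasurable)
      hIi.norm (fun n => Eventually.of_forall fun z => ?_) (Eventually.of_forall fun z => ?_)
    · rw [norm_mul, Real.norm_eq_abs, abs_of_nonneg (hΨ01 n z).1]
      exact mul_le_of_le_one_left (norm_nonneg _) (hΨ01 n z).2
    · have h := (hΨlim z).mul_const ⟪F z, gradient φ z⟫
      refine h.congr' (Eventually.of_forall fun n => rfl) |>.trans ?_
      by_cases hz : z ∈ U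
      · rw [indicator_of_mem hz, indicator_of_mem hz, one_mul]
      · rw [indicator_of_notMem hz, indicator_of_notMem hz, zero_mul]
  -- (3) the ball terms converge
  have hL3 : Tendsto (fun n => ⨍ z in ball c r, Ψ n z * φ z) atTop (𝓝 (⨍ z in ball c r, φ z)) := by
    simp only [setAverage_eq, smul_eq_mul]
    refine Tendsto.const_mul _ (tendsto_integral_of_dominated_convergence (fun z => |φ z|) (fun n => ?_) ?_
      (fun n => Eventually.of_forall fun z => ?_) ?_)
    · exact ((hΨ1 n).continuous.mul hφ.1.continuous).aestronglyMeasurable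
    · exact ((hφ.1.continuous.abs).integrable_of_hasCompactSupport hφ.2.abs).integrableOn
    · rw [Real.norm_eq_abs, abs_mul, abs_of_nonneg (hΨ01 n z).1]
      exact mul_le_of_le_one_left (abs_nonneg _) (hΨ01 n z).2
    · rw [ae_restrict_iff' measurableSet_ball]
      refine Eventually.of_forall fun z hz => ?_
      have h := (hΨlim z).mul_const (φ z)
      rwa [indicator_of_mem (hball hz), one_mul] at h
  -- (4) the wall terms tend to zero
  have hL2 : Tendsto (fun n => ∫ z, φ z * ⟪F z, gradient (Ψ n) z⟫) atTop (𝓝 0) := by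
    -- expand `⟪F, ∇Ψ n⟫ = D(Ψ n)(F) = Σₘ …`
    have hexp : ∀ n z, φ z * ⟪F z, gradient (Ψ n) z⟫ = ∑ m ∈ M,
        -(((n : ℝ) + 1) * deriv Real.smoothTransition (((n : ℝ) + 1) * (α m - ⟪z, W m⟫) - 1) *
          ((∏ m' ∈ M.erase m, wallCut (W m') (α m') (n + 1) z) * φ z * ⟪F z, W m⟫)) := fun n z => by
      rw [gradient, real_inner_comm, toDual_symm_apply, hΨ, fderiv_polyCut_apply, Finset.mul_sum]
      refine Finset.sum_congr rfl fun m _ => ?_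
      push_cast
      ring
    have hterm : ∀ m ∈ M, Tendsto (fun n : ℕ => ∫ z, -(((n : ℝ) + 1) *
        deriv Real.smoothTransition (((n : ℝ) + 1) * (α m - ⟪z, W m⟫) - 1) *
          ((∏ m' ∈ M.erase m, wallCut (W m') (α m') (n + 1) z) * φ z * ⟪F z, W m⟫))) atTop (𝓝 0) := fun m hm => by
      have h := tendsto_layer_integral (hWne m hm) (α m) hF (hwall m hm) hφ
        (P := fun n z => ∏ m' ∈ M.erase m, wallCut (W m') (α m') (n + 1) z)
        (fun n z => prod_erase_wallCut_mem_Icc M W α (n + 1) m z)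
      have h' := h.neg
      rw [neg_zero] at h'
      refine h'.congr fun n => ?_
      rw [← integral_neg]
    have hint : ∀ n : ℕ, ∀ m ∈ M, Integrable fun z => -(((n : ℝ) + 1) *
        deriv Real.smoothTransition (((n : ℝ) + 1) * (α m - ⟪z, W m⟫) - 1) *
          ((∏ m' ∈ M.erase m, wallCut (W m') (α m') (n + 1) z) * φ z * ⟪F z, W m⟫)) := fun n m _ => by
      refine Continuous.integrable_of_hasCompactSupport ?_ ?_
      · have hθ'c : Continuous (deriv Real.smoothTransition) :=
          (Real.smoothTransition.contDiff (n := 1)).continuous_deriv le_rfl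
        refine (continuous_const.mul ((hθ'c.comp ((continuous_const.mul
          (continuous_const.sub (continuous_id.inner continuous_const))).sub continuous_const)))).mul
          (((continuous_finsetProd _ fun m' _ => (contDiff_wallCut (W m') (α m') (n + 1)).continuous).mul
            hφ.1.continuous).mul (hF.inner continuous_const)) |>.neg
      · exact ((hφ.2.mul_left.mul_right).mul_left).neg
    have hsum : ∀ n, ∫ z, φ z * ⟪F z, gradient (Ψ n) z⟫ = ∑ m ∈ M, ∫ z, -(((n : ℝ) + 1) *
        deriv Real.smoothTransition (((n : ℝ) + 1) * (α m - ⟪z, W m⟫) - 1) *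
          ((∏ m' ∈ M.erase m, wallCut (W m') (α m') (n + 1) z) * φ z * ⟪F z, W m⟫)) := fun n => by
      rw [← integral_finsetSum _ (hint n)]
      exact integral_congr_ae (Eventually.of_forall fun z => hexp n z)
    simp_rw [hsum]
    have := tendsto_finsetSum M hterm
    rwa [Finset.sum_const_zero] at this
  -- (5) conclude
  have hlim := (hL1.add hL2).congr' ?_  |> fun h => tendsto_nhds_unique h hL3.neg
  · rw [add_zero] at hlim
    exact hlim
  · exact Eventually.of_forall fun n => hid n

/-- **Registered sub-goal `fccMirror_wall`** (line `flux-cell-joint-census`, support of `stub_fccMirrorExact`):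
the wall lemma of the method of images, binder form of `setIntegral_inner_gradient_of_tangent`. [folklore] -/
theorem fccMirror_wall : ∀ {ι : Type} (M : Finset ι) (W : ι → E8) (α : ι → ℝ) (F : E8 → E8) (c : E8) (r : ℝ),
    (∀ m ∈ M, W m ≠ 0) → Continuous F → (∀ m ∈ M, ∀ z : E8, inner ℝ z (W m) = α m → inner ℝ (F z) (W m) = 0) →
    Metric.ball c r ⊆ {z | ∀ m ∈ M, inner ℝ z (W m) < α m} →
    (∀ Φ : E8 → ℝ, IsTest Φ → tsupport Φ ⊆ {z | ∀ m ∈ M, inner ℝ z (W m) < α m} →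
      ∫ z, inner ℝ (F z) (gradient Φ z) = -⨍ z in Metric.ball c r, Φ z) →
    ∀ φ : E8 → ℝ, IsTest φ →
    ∫ z in {z | ∀ m ∈ M, inner ℝ z (W m) < α m}, inner ℝ (F z) (gradient φ z) = -⨍ z in Metric.ball c r, φ z :=
  fun M W α _ _ _ hWne hF hwall hball hW0 _ hφ => setIntegral_inner_gradient_of_tangent (M := M) (W := W) (α := α)
    hWne hF hwall hball hW0 hφ

end Wall

end Summit.AtomisticToContinuum.Crystallization.Theorems.PricedLinkCensusLocalToGlobal

end
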